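import Literature.Probability.MarkovChains.TotalVariation
import HarnessLib

/-!
# The Neyman–Pearson fundamental lemma (finite sample space)

Topic `Literature/Probability/HypothesisTesting`.  Source: E. L. Lehmann, J. P. Romano, *Testing
Statistical Hypotheses*, 3rd ed., Springer 2005, §3.1 (randomised tests, size and power, eqs.
(3.4)–(3.5), p. 58) and §3.2, **Theorem 3.2.1** (the fundamental lemma of Neyman and Pearson,
eqs. (3.7)–(3.8), pp. 59–61) [LehmannRomano2005].  The printed theorem is stated for densities
`p₀`, `p₁` with respect to an arbitrary measure `μ`; this file is the case of a FINITE sample space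
`X` with counting measure (every `∫ … dμ` is a `Finset.univ` sum), which is the case of the
sampling-validation statistics that consume it (click patterns / bit strings).

HONEST FRAMING (pub-qadeq lane context, CLAIMS rows E-11…E-15: the ‘Bayesian test’, ‘likelihood
test’ and ‘HOG ratio test’ by which Gaussian-boson-sampling experiments are validated AGAINST NAMED
MOCK-UP HYPOTHESES — thermal light, distinguishable photons, uniform — are likelihood-ratio tests
between two simple hypotheses): instance-level adjudication of specific advantage claims; no claim
about BQP vs BPP or the summit.  This file proves a 1933 theorem of mathematical statistics and
types what such a test is optimal FOR (discriminating `p₁` from the one named `p₀`); it asserts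
nothing about any experiment, any mock-up, or any unlisted hypothesis.

## Contents (all proved, 0 named facts)

* `IsTest φ` — a (randomised) test / critical function: `0 ≤ φ x ≤ 1` is the probability of
  rejecting `H : p₀` when `x` is observed [cite: LehmannRomano2005, §3.1 p. 58];
  `rejProb p φ = Σ_x φ x · p x` — its rejection probability `E_p φ(X)` under the density `p`
  (the SIZE for `p = p₀`, eq. (3.5)/(3.7); the POWER `β` for `p = p₁`, eq. (3.4)).
* `IsLRTest p₀ p₁ k φ` — the likelihood-ratio form (3.8): `φ x = 1` when `p₁ x > k·p₀ x` and
  `φ x = 0` when `p₁ x < k·p₀ x` (arbitrary on the boundary `p₁ x = k·p₀ x`).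
* `sum_sub_mul_sub_nonneg` — the key display of the printed proof of (ii):
  `∫ (φ − φ*)(p₁ − k p₀) dμ ≥ 0` for an LR test `φ` and ANY test `φ*`;
  `mul_size_sub_le_power_sub` — hence `∫(φ − φ*) p₁ dμ ≥ k ∫(φ − φ*) p₀ dμ` (second display).
* `power_le_power_of_isLRTest` — **Theorem 3.2.1 (ii)** (sufficiency): an LR test (`k ≥ 0`) is most
  powerful at its own level — every test whose size does not exceed its size has no larger power.
* `exists_isLRTest_size_eq` — **Theorem 3.2.1 (i)** (existence), finite case: for a probability
  vector `p₀`, a non-negative `p₁` and every `0 ≤ α ≤ 1` there are `k ≥ 0` and a test of the form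
  (3.8) — constant `γ` on the boundary, `lrTest p₀ p₁ k γ` — whose size is EXACTLY `α` (the printed
  construction: `α(c) = P₀{p₁ > c p₀}`, the threshold `c₀` with `α(c₀) ≤ α ≤ α(c₀ − 0)`, boundary
  randomisation `(α − α(c₀)) / (α(c₀−0) − α(c₀))`; here `c₀` is found among the finitely many
  ratios `p₁ x / p₀ x`).
* `bayesRisk_le_of_isLRTest` — the Bayes form (folklore corollary of the same inequality): with
  prior weights `π₀ ≥ 0`, `π₁ > 0` the LR test with `k = π₀/π₁` minimises
  `π₀·E₀φ + π₁·(c − E₁φ)` (weighted type-I plus type-II error) over all tests.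
* `power_sub_size_le_tvDist`, `power_sub_size_lrOne_eq_tvDist`, `abs_power_sub_size_le_tvDist` —
  the case `k = 1` for two laws of equal mass: the ADVANTAGE `E₁φ − E₀φ` of every randomised test is
  at most the total variation distance `‖p₁ − p₀‖_TV` of the tree
  (`Literature.Probability.MarkovChains.tvDist`, [cite: LevinPeres2017, Prop. 4.2 / Remark 4.3]),
  with equality for the LR test `𝟙{p₀ ≤ p₁}` (folklore; the event form is the tree's
  `tvDist_eq_sum_filter`).

Not covered: part (iii) of Theorem 3.2.1 (necessity a.e.), general measure spaces, composite
hypotheses (§3.3 ff.), and anything about specific distributions.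
-/

noncomputable section

namespace Literature.Probability.HypothesisTesting

open Finset

variable {X : Type*} [Fintype X]

/-! ## Tests, size, power, likelihood-ratio form -/

/-- A (randomised) **test** or critical function on the sample space `X`: `φ x ∈ [0, 1]` is the
probability of rejecting the hypothesis when `x` is observed. [cite: LehmannRomano2005, §3.1 p. 58] -/
def IsTest (φ : X → ℝ) : Prop := ∀ x, 0 ≤ φ x ∧ φ x ≤ 1

/-- The rejection probability `E_p φ(X) = Σ_x φ(x) p(x)` of the test `φ` under the density `p`
(counting measure on the finite `X`): the size when `p = p₀`, the power when `p = p₁`.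
[cite: LehmannRomano2005, §3.1 eqs. (3.4)–(3.5)] -/
def rejProb (p : X → ℝ) (φ : X → ℝ) : ℝ := ∑ x, φ x * p x

/-- The **likelihood-ratio form** (3.8) with constant `k`: reject surely where `p₁ > k p₀`, accept
surely where `p₁ < k p₀`, anything (in `[0,1]`) on the boundary. [cite: LehmannRomano2005, §3.2 Theorem 3.2.1 eq. (3.8)] -/
def IsLRTest (p₀ p₁ : X → ℝ) (k : ℝ) (φ : X → ℝ) : Prop :=
  IsTest φ ∧ (∀ x, k * p₀ x < p₁ x → φ x = 1) ∧ (∀ x, p₁ x < k * p₀ x → φ x = 0)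

omit [Fintype X] in
/-- The constant test `φ ≡ a` (`0 ≤ a ≤ 1`) is a test; its rejection probability under a law of
mass one is `a` (used in the book's proof of Corollary 3.2.1). [cite: LehmannRomano2005, §3.2 Corollary 3.2.1 (proof)] -/
theorem isTest_const {a : ℝ} (ha0 : 0 ≤ a) (ha1 : a ≤ 1) : IsTest (fun _ : X => a) :=
  fun _ => ⟨ha0, ha1⟩

/-- The constant test `φ ≡ a` has rejection probability `a · Σ p` (`= a` under a law of mass one:
“the level-α test given by φ(x) ≡ α has power α”). [cite: LehmannRomano2005, §3.2 Corollary 3.2.1 (proof)] -/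
theorem rejProb_const (p : X → ℝ) (a : ℝ) : rejProb p (fun _ : X => a) = a * ∑ x, p x := by
  unfold rejProb; rw [mul_sum]

/-- `0 ≤ E_p φ` for a test (`0 ≤ φ`) and a non-negative density. [cite: LehmannRomano2005, §3.1 (0 ≤ φ(x) ≤ 1, eq. (3.4))] -/
theorem rejProb_nonneg {p φ : X → ℝ} (hp : ∀ x, 0 ≤ p x) (hφ : IsTest φ) : 0 ≤ rejProb p φ :=
  sum_nonneg fun x _ => mul_nonneg (hφ x).1 (hp x)

/-- `E_p φ ≤ Σ p` (`= 1` for a probability vector) for a test (`φ ≤ 1`) and a non-negative density.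
[cite: LehmannRomano2005, §3.1 (0 ≤ φ(x) ≤ 1, eq. (3.4))] -/
theorem rejProb_le_sum {p φ : X → ℝ} (hp : ∀ x, 0 ≤ p x) (hφ : IsTest φ) :
    rejProb p φ ≤ ∑ x, p x :=
  sum_le_sum fun x _ => by
    have := mul_le_mul_of_nonneg_right (hφ x).2 (hp x); rwa [one_mul] at this

omit [Fintype X] in
/-- The complementary test `1 − φ` (plumbing for the two-sided bound). [folklore] -/
private theorem isTest_one_sub {φ : X → ℝ} (hφ : IsTest φ) : IsTest (fun x => 1 - φ x) :=
  fun x => ⟨by linarith [(hφ x).2], by linarith [(hφ x).1]⟩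

/-- `E_p(1 − φ) = Σ p − E_p φ` (plumbing). [folklore] -/
private theorem rejProb_one_sub (p φ : X → ℝ) :
    rejProb p (fun x => 1 - φ x) = (∑ x, p x) - rejProb p φ := by
  unfold rejProb; rw [← sum_sub_distrib]; exact sum_congr rfl fun x _ => by ring

/-! ## Theorem 3.2.1 (ii): likelihood-ratio tests are most powerful -/

/-- The key display in the proof of Theorem 3.2.1 (ii): if `φ` has the form (3.8) and `φ*` is any
test, then `∫ (φ − φ*)(p₁ − k p₀) dμ ≥ 0` — on `{φ − φ* > 0}` one has `φ > 0` hence `p₁ ≥ k p₀`, on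
`{φ − φ* < 0}` one has `φ < 1` hence `p₁ ≤ k p₀`.  No sign or normalisation hypothesis on `p₀`,
`p₁`, `k` is needed. [cite: LehmannRomano2005, §3.2 Theorem 3.2.1, proof of (ii) (first display)] -/
theorem sum_sub_mul_sub_nonneg {p₀ p₁ : X → ℝ} {k : ℝ} {φ φ' : X → ℝ}
    (hφ : IsLRTest p₀ p₁ k φ) (hφ' : IsTest φ') :
    0 ≤ ∑ x, (φ x - φ' x) * (p₁ x - k * p₀ x) := by
  refine sum_nonneg fun x _ => ?_
  rcases lt_trichotomy (k * p₀ x) (p₁ x) with h | h | h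
  · rw [hφ.2.1 x h]
    exact mul_nonneg (by linarith [(hφ' x).2]) (by linarith)
  · rw [← h, sub_self, mul_zero]
  · rw [hφ.2.2 x h]
    exact mul_nonneg_of_nonpos_of_nonpos (by linarith [(hφ' x).1]) (by linarith)

/-- Second display of the proof of Theorem 3.2.1 (ii): the difference in power dominates `k` times
the difference in size, `∫ (φ − φ*) p₁ dμ ≥ k ∫ (φ − φ*) p₀ dμ`.
[cite: LehmannRomano2005, §3.2 Theorem 3.2.1, proof of (ii) (second display)] -/
theorem mul_size_sub_le_power_sub {p₀ p₁ : X → ℝ} {k : ℝ} {φ φ' : X → ℝ}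
    (hφ : IsLRTest p₀ p₁ k φ) (hφ' : IsTest φ') :
    k * (rejProb p₀ φ - rejProb p₀ φ') ≤ rejProb p₁ φ - rejProb p₁ φ' := by
  have h := sum_sub_mul_sub_nonneg hφ hφ'
  have hexp : ∑ x, (φ x - φ' x) * (p₁ x - k * p₀ x) =
      (rejProb p₁ φ - rejProb p₁ φ') - k * (rejProb p₀ φ - rejProb p₀ φ') := by
    unfold rejProb
    rw [mul_sub, mul_sum, mul_sum, ← sum_sub_distrib, ← sum_sub_distrib, ← sum_sub_distrib]
    exact sum_congr rfl fun x _ => by ring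
  linarith

/-- **Theorem 3.2.1 (ii) (Neyman–Pearson): a likelihood-ratio test is most powerful at its level.**
If `φ` has the form (3.8) with `k ≥ 0`, then every test `φ*` with `E₀ φ* ≤ E₀ φ` has
`E₁ φ* ≤ E₁ φ`. [cite: LehmannRomano2005, §3.2 Theorem 3.2.1 (ii)] -/
theorem power_le_power_of_isLRTest {p₀ p₁ : X → ℝ} {k : ℝ} {φ φ' : X → ℝ}
    (hφ : IsLRTest p₀ p₁ k φ) (hk : 0 ≤ k) (hφ' : IsTest φ')
    (hsize : rejProb p₀ φ' ≤ rejProb p₀ φ) : rejProb p₁ φ' ≤ rejProb p₁ φ := by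
  have h := mul_size_sub_le_power_sub hφ hφ'
  nlinarith [mul_nonneg hk (sub_nonneg.mpr hsize)]

/-- **Bayes form.** With prior weights `π₀ ≥ 0` and `π₁ > 0`, the likelihood-ratio test with
threshold `k = π₀ / π₁` minimises the weighted error `π₀ · E₀ φ + π₁ · (c − E₁ φ)` (for a
probability vector `p₁` and `c = 1` the second term is `π₁` times the probability of an error of the
second kind) over all tests.  (Folklore corollary of the second display of the proof of Theorem
3.2.1 (ii); it is the optimality that a ‘Bayesian test’ deciding by the sign of
`log (π₁ p₁(x) / (π₀ p₀(x)))` enjoys: the Bayes solution of the two-decision problem chooses `d₁` iff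
`a·P{Θ ∈ ω₁ | x} > b·P{Θ ∈ ω₀ | x}`, here with `a = b`, `ω₀ = {p₀}`, `ω₁ = {p₁}`.)
[cite: LehmannRomano2005, Ch. 1 Problem 1.8 (ii) (structure of Bayes solutions, two-decision problem)] -/
theorem bayesRisk_le_of_isLRTest {p₀ p₁ : X → ℝ} {π₀ π₁ : ℝ} {φ φ' : X → ℝ}
    (hφ : IsLRTest p₀ p₁ (π₀ / π₁) φ) (hπ₁ : 0 < π₁) (hφ' : IsTest φ') (c : ℝ) :
    π₀ * rejProb p₀ φ + π₁ * (c - rejProb p₁ φ) ≤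
      π₀ * rejProb p₀ φ' + π₁ * (c - rejProb p₁ φ') := by
  have h := mul_size_sub_le_power_sub hφ hφ'
  have h' : π₀ * (rejProb p₀ φ - rejProb p₀ φ') ≤ π₁ * (rejProb p₁ φ - rejProb p₁ φ') := by
    have h2 := mul_le_mul_of_nonneg_left h hπ₁.le
    have h3 : π₁ * (π₀ / π₁ * (rejProb p₀ φ - rejProb p₀ φ')) =
        π₀ * (rejProb p₀ φ - rejProb p₀ φ') := by
      field_simp
    linarith
  linarith

/-! ## Theorem 3.2.1 (i): existence of a likelihood-ratio test of prescribed size (finite case) -/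

section Existence

variable (p₀ p₁ : X → ℝ)

/-- `α(k) = P₀{p₁(X) > k p₀(X)}` — the size of the non-randomised test `{p₁ > k p₀}`.
[cite: LehmannRomano2005, §3.2 Theorem 3.2.1, proof of (i)] -/
def sizeAbove (k : ℝ) : ℝ := ∑ x ∈ univ.filter (fun x => k * p₀ x < p₁ x), p₀ x

/-- `P₀{p₁(X) ≥ k p₀(X)}` (`= α(k − 0)` for `k > 0`). [cite: LehmannRomano2005, §3.2 Theorem 3.2.1, proof of (i)] -/
def sizeAtLeast (k : ℝ) : ℝ := ∑ x ∈ univ.filter (fun x => k * p₀ x ≤ p₁ x), p₀ x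

/-- `P₀{p₁(X) = k p₀(X)}` — the mass of the boundary set. [cite: LehmannRomano2005, §3.2 Theorem 3.2.1, proof of (i)] -/
def sizeBoundary (k : ℝ) : ℝ := ∑ x ∈ univ.filter (fun x => k * p₀ x = p₁ x), p₀ x

/-- The likelihood-ratio test with threshold `k` and the constant value `γ` on the boundary
`{p₁ = k p₀}` — the test `φ` displayed in the proof of Theorem 3.2.1 (i).
[cite: LehmannRomano2005, §3.2 Theorem 3.2.1, proof of (i)] -/
def lrTest (k γ : ℝ) : X → ℝ := fun x =>
  if k * p₀ x < p₁ x then 1 else if p₁ x < k * p₀ x then 0 else γ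

variable {p₀ p₁}

omit [Fintype X] in
/-- `lrTest k γ` has the likelihood-ratio form (3.8) (and is a test when `γ ∈ [0,1]`).
[cite: LehmannRomano2005, §3.2 Theorem 3.2.1, proof of (i) (the displayed φ)] -/
theorem isLRTest_lrTest (k : ℝ) {γ : ℝ} (hγ0 : 0 ≤ γ) (hγ1 : γ ≤ 1) :
    IsLRTest p₀ p₁ k (lrTest p₀ p₁ k γ) := by
  refine ⟨fun x => ?_, fun x hx => by simp [lrTest, hx], fun x hx => ?_⟩
  · unfold lrTest
    split_ifs <;> first | exact ⟨hγ0, hγ1⟩ | exact ⟨le_rfl, zero_le_one⟩ | exact ⟨zero_le_one, le_rfl⟩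
  · have : ¬ k * p₀ x < p₁ x := not_lt.mpr hx.le
    simp [lrTest, this, hx]

/-- `P₀{p₁ ≥ k p₀} = P₀{p₁ > k p₀} + P₀{p₁ = k p₀}` (plumbing). [folklore] -/
private theorem sizeAtLeast_eq_sizeAbove_add_sizeBoundary (k : ℝ) :
    sizeAtLeast p₀ p₁ k = sizeAbove p₀ p₁ k + sizeBoundary p₀ p₁ k := by
  unfold sizeAtLeast sizeAbove sizeBoundary
  rw [sum_filter, sum_filter, sum_filter, ← sum_add_distrib]
  refine sum_congr rfl fun x _ => ?_
  rcases lt_trichotomy (k * p₀ x) (p₁ x) with h | h | h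
  · simp [h, h.le, h.ne]
  · simp [h]
  · simp [not_le.mpr h, not_lt.mpr h.le, h.ne']

/-- The boundary mass is non-negative (plumbing). [folklore] -/
private theorem sizeBoundary_nonneg (hp₀ : ∀ x, 0 ≤ p₀ x) (k : ℝ) : 0 ≤ sizeBoundary p₀ p₁ k :=
  sum_nonneg fun x _ => hp₀ x

/-- The size (under any density `p`) of `lrTest k γ` is `Σ_{p₁ > k p₀} p + γ · Σ_{p₁ = k p₀} p`; for
`p = p₀` this is the display `E₀ φ(X) = P₀{…> c₀} + γ P₀{… = c₀}` of the printed proof.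
[cite: LehmannRomano2005, §3.2 Theorem 3.2.1, proof of (i) (last display)] -/
theorem rejProb_lrTest (p : X → ℝ) (k γ : ℝ) :
    rejProb p (lrTest p₀ p₁ k γ) =
      (∑ x ∈ univ.filter (fun x => k * p₀ x < p₁ x), p x) +
        γ * ∑ x ∈ univ.filter (fun x => k * p₀ x = p₁ x), p x := by
  unfold rejProb
  rw [sum_filter, sum_filter, mul_sum, ← sum_add_distrib]
  refine sum_congr rfl fun x _ => ?_
  unfold lrTest
  rcases lt_trichotomy (k * p₀ x) (p₁ x) with h | h | h
  · simp [h, h.ne]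
  · simp [h]
  · simp [not_lt.mpr h.le, h, h.ne']

/-- `E₀ φ = α(k) + γ · P₀{p₁ = k p₀}` for `φ = lrTest k γ`. [cite: LehmannRomano2005, §3.2 Theorem 3.2.1, proof of (i) (last display)] -/
theorem rejProb_lrTest_self (k γ : ℝ) :
    rejProb p₀ (lrTest p₀ p₁ k γ) = sizeAbove p₀ p₁ k + γ * sizeBoundary p₀ p₁ k :=
  rejProb_lrTest p₀ k γ

/-- **Theorem 3.2.1 (i) (existence), finite sample space.**  For a probability vector `p₀`, a
non-negative `p₁` and a level `0 ≤ α ≤ 1` there exist a constant `k ≥ 0` and a boundary value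
`γ ∈ [0, 1]` such that the likelihood-ratio test `lrTest p₀ p₁ k γ` (form (3.8)) has size exactly `α`
(eq. (3.7)). [cite: LehmannRomano2005, §3.2 Theorem 3.2.1 (i)] -/
theorem exists_lrTest_size_eq (hp₀ : ∀ x, 0 ≤ p₀ x) (hp₀1 : ∑ x, p₀ x = 1) (hp₁ : ∀ x, 0 ≤ p₁ x)
    {α : ℝ} (hα0 : 0 ≤ α) (hα1 : α ≤ 1) :
    ∃ k γ : ℝ, 0 ≤ k ∧ 0 ≤ γ ∧ γ ≤ 1 ∧ rejProb p₀ (lrTest p₀ p₁ k γ) = α := by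
  classical
  -- the finitely many candidate thresholds: 0 and the likelihood ratios at points of positive p₀-mass
  set T : Finset ℝ :=
    insert 0 ((univ.filter fun x => 0 < p₀ x).image fun x => p₁ x / p₀ x) with hT
  have hT0 : (0 : ℝ) ∈ T := mem_insert_self _ _
  have hTne : T.Nonempty := ⟨0, hT0⟩
  have hTnn : ∀ c ∈ T, 0 ≤ c := by
    intro c hc
    rcases mem_insert.mp hc with rfl | hc
    · exact le_rfl
    · obtain ⟨x, hx, rfl⟩ := mem_image.mp hc
      exact div_nonneg (hp₁ x) (hp₀ x)
  have hratio_mem : ∀ x, 0 < p₀ x → p₁ x / p₀ x ∈ T := fun x hx =>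
    mem_insert_of_mem (mem_image.mpr ⟨x, mem_filter.mpr ⟨mem_univ _, hx⟩, rfl⟩)
  -- (a) at the largest ratio the strict test has size 0 ≤ α
  set M := T.max' hTne with hM
  have hA_M : sizeAbove p₀ p₁ M ≤ α := by
    have : sizeAbove p₀ p₁ M = 0 := by
      refine sum_eq_zero fun x hx => ?_
      rw [mem_filter] at hx
      by_contra hne
      have hpos : 0 < p₀ x := lt_of_le_of_ne (hp₀ x) (Ne.symm hne)
      have hle : p₁ x / p₀ x ≤ M := le_max' _ _ (hratio_mem x hpos)
      rw [div_le_iff₀ hpos] at hle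
      linarith [hx.2]
    rw [this]; exact hα0
  -- the admissible thresholds and the smallest one
  set S := T.filter fun c => sizeAbove p₀ p₁ c ≤ α with hS
  have hSne : S.Nonempty := ⟨M, mem_filter.mpr ⟨max'_mem _ _, hA_M⟩⟩
  set k := S.min' hSne with hk
  have hkS : k ∈ S := min'_mem _ _
  have hkT : k ∈ T := (mem_filter.mp hkS).1
  have hk0 : 0 ≤ k := hTnn k hkT
  have hA_k : sizeAbove p₀ p₁ k ≤ α := (mem_filter.mp hkS).2
  -- (b) α ≤ P₀{p₁ ≥ k p₀}
  have hB_k : α ≤ sizeAtLeast p₀ p₁ k := by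
    rcases hk0.eq_or_lt with hk00 | hkpos
    · -- k = 0: the set {p₁ ≥ 0} is everything
      have : sizeAtLeast p₀ p₁ k = 1 := by
        unfold sizeAtLeast
        rw [← hp₀1]
        refine sum_congr (filter_true_of_mem fun x _ => ?_) fun _ _ => rfl
        rw [← hk00, zero_mul]; exact hp₁ x
      rw [this]; exact hα1
    · -- k > 0: compare with the next smaller candidate threshold c'
      set L := T.filter fun c => c < k with hL
      have hLne : L.Nonempty := ⟨0, mem_filter.mpr ⟨hT0, hkpos⟩⟩
      set c' := L.max' hLne with hc'
      have hc'L : c' ∈ L := max'_mem _ _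
      have hc'T : c' ∈ T := (mem_filter.mp hc'L).1
      have hc'k : c' < k := (mem_filter.mp hc'L).2
      have hc'S : c' ∉ S := fun h => (not_le.mpr hc'k) (min'_le _ _ h)
      have hA_c' : α < sizeAbove p₀ p₁ c' := by
        by_contra h
        exact hc'S (mem_filter.mpr ⟨hc'T, not_lt.mp h⟩)
      have hsub : univ.filter (fun x => c' * p₀ x < p₁ x) ⊆
          univ.filter (fun x => k * p₀ x ≤ p₁ x) := by
        intro x hx
        rw [mem_filter] at hx ⊢
        refine ⟨mem_univ _, ?_⟩
        rcases (hp₀ x).eq_or_lt with h0 | hpos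
        · rw [← h0, mul_zero]; exact hp₁ x
        · have hr : p₁ x / p₀ x ∈ T := hratio_mem x hpos
          have hc'r : c' < p₁ x / p₀ x := by rw [lt_div_iff₀ hpos]; exact hx.2
          have hkr : k ≤ p₁ x / p₀ x := by
            by_contra h
            have hrL : p₁ x / p₀ x ∈ L := mem_filter.mpr ⟨hr, not_le.mp h⟩
            exact (not_le.mpr hc'r) (le_max' _ _ hrL)
          rwa [le_div_iff₀ hpos] at hkr
      have hmono : sizeAbove p₀ p₁ c' ≤ sizeAtLeast p₀ p₁ k :=
        sum_le_sum_of_subset_of_nonneg hsub fun x _ _ => hp₀ x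
      linarith
  -- choose the boundary randomisation γ
  rw [sizeAtLeast_eq_sizeAbove_add_sizeBoundary] at hB_k
  have hE0 : 0 ≤ sizeBoundary p₀ p₁ k := sizeBoundary_nonneg hp₀ k
  by_cases hE : sizeBoundary p₀ p₁ k = 0
  · refine ⟨k, 0, hk0, le_rfl, zero_le_one, ?_⟩
    rw [rejProb_lrTest_self, hE]; linarith
  · have hEpos : 0 < sizeBoundary p₀ p₁ k := lt_of_le_of_ne hE0 (Ne.symm hE)
    refine ⟨k, (α - sizeAbove p₀ p₁ k) / sizeBoundary p₀ p₁ k, hk0,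
      div_nonneg (by linarith) hE0, ?_, ?_⟩
    · rw [div_le_one hEpos]; linarith
    · rw [rejProb_lrTest_self, div_mul_cancel₀ _ hE]; ring

/-- Theorem 3.2.1 (i) in the form "there is a test satisfying (3.7) and (3.8)".
[cite: LehmannRomano2005, §3.2 Theorem 3.2.1 (i)] -/
theorem exists_isLRTest_size_eq (hp₀ : ∀ x, 0 ≤ p₀ x) (hp₀1 : ∑ x, p₀ x = 1)
    (hp₁ : ∀ x, 0 ≤ p₁ x) {α : ℝ} (hα0 : 0 ≤ α) (hα1 : α ≤ 1) :
    ∃ (k : ℝ) (φ : X → ℝ), 0 ≤ k ∧ IsLRTest p₀ p₁ k φ ∧ rejProb p₀ φ = α := by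
  obtain ⟨k, γ, hk, hγ0, hγ1, h⟩ := exists_lrTest_size_eq hp₀ hp₀1 hp₁ hα0 hα1
  exact ⟨k, lrTest p₀ p₁ k γ, hk, isLRTest_lrTest k hγ0 hγ1, h⟩

/-- (i) + (ii) together: a most powerful level-`α` test exists and is of likelihood-ratio form — for
every level `α ∈ [0,1]` there is an LR test of size `α` whose power no test of size `≤ α` exceeds.
[cite: LehmannRomano2005, §3.2 Theorem 3.2.1 (i)–(ii)] -/
theorem exists_mostPowerful (hp₀ : ∀ x, 0 ≤ p₀ x) (hp₀1 : ∑ x, p₀ x = 1)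
    (hp₁ : ∀ x, 0 ≤ p₁ x) {α : ℝ} (hα0 : 0 ≤ α) (hα1 : α ≤ 1) :
    ∃ (k : ℝ) (φ : X → ℝ), 0 ≤ k ∧ IsLRTest p₀ p₁ k φ ∧ rejProb p₀ φ = α ∧
      ∀ φ', IsTest φ' → rejProb p₀ φ' ≤ α → rejProb p₁ φ' ≤ rejProb p₁ φ := by
  obtain ⟨k, φ, hk, hφ, hsize⟩ := exists_isLRTest_size_eq hp₀ hp₀1 hp₁ hα0 hα1
  exact ⟨k, φ, hk, hφ, hsize, fun φ' hφ' hα' =>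
    power_le_power_of_isLRTest hφ hk hφ' (hsize ▸ hα')⟩

end Existence

/-! ## The case `k = 1`: the best advantage of a test is the total variation distance -/

section TotalVariation

variable {p₀ p₁ : X → ℝ}

/-- The non-randomised likelihood-ratio test `𝟙{p₀ ≤ p₁}` (form (3.8) with threshold `k = 1`, boundary
included) — the indicator of the event `B = {x : μ(x) ≥ ν(x)}` that realises the total variation
distance. [cite: LevinPeres2017, Remark 4.3 eq. (4.5)] -/
def lrOne (p₀ p₁ : X → ℝ) : X → ℝ := fun x => if p₀ x ≤ p₁ x then 1 else 0

omit [Fintype X] in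
/-- `𝟙{p₀ ≤ p₁}` has the form (3.8) with `k = 1`. [cite: LehmannRomano2005, §3.2 Theorem 3.2.1 eq. (3.8) (k = 1)] -/
theorem isLRTest_lrOne (p₀ p₁ : X → ℝ) : IsLRTest p₀ p₁ 1 (lrOne p₀ p₁) := by
  refine ⟨fun x => ?_, fun x hx => ?_, fun x hx => ?_⟩
  · unfold lrOne; split_ifs <;> simp
  · rw [one_mul] at hx; simp [lrOne, hx.le]
  · rw [one_mul] at hx; simp [lrOne, not_le.mpr hx]

/-- `E_p 𝟙_B = p(B)` for `B = {p₀ ≤ p₁}` (plumbing). [folklore] -/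
private theorem rejProb_lrOne (p : X → ℝ) :
    rejProb p (lrOne p₀ p₁) = ∑ x ∈ univ.filter (fun x => p₀ x ≤ p₁ x), p x := by
  unfold rejProb lrOne
  rw [sum_filter]
  exact sum_congr rfl fun x _ => by split_ifs <;> simp

/-- For two laws of equal total mass, the LR test `𝟙{p₀ ≤ p₁}` has advantage `E₁φ − E₀φ` equal to
`‖p₁ − p₀‖_TV` (the tree's `tvDist_eq_sum_filter`). [cite: LevinPeres2017, Remark 4.3 eq. (4.5)] -/
theorem power_sub_size_lrOne_eq_tvDist [DecidableEq X] (hmass : ∑ x, p₁ x = ∑ x, p₀ x) :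
    rejProb p₁ (lrOne p₀ p₁) - rejProb p₀ (lrOne p₀ p₁) =
      Literature.Probability.MarkovChains.tvDist p₁ p₀ := by
  rw [rejProb_lrOne, rejProb_lrOne, Literature.Probability.MarkovChains.tvDist_eq_sum_filter hmass,
    sum_sub_distrib]

/-- **The advantage of every randomised test is at most the total variation distance**: for two
laws of equal mass and every test `φ`, `E₁ φ − E₀ φ ≤ ‖p₁ − p₀‖_TV` (Theorem 3.2.1 (ii)'s inequality
at `k = 1` against the LR test `𝟙{p₀ ≤ p₁}`).  This is the operational meaning of the TV bounds
quoted for samplers: no single-sample accept/reject procedure separates the two laws by more.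
(Corollary of Theorem 3.2.1 (ii)'s second proof display at `k = 1`, with the event form (4.5) of the total
variation distance.) [cite: LehmannRomano2005, §3.2 Theorem 3.2.1 (ii) (k = 1); LevinPeres2017, Remark 4.3 eq. (4.5)] -/
theorem power_sub_size_le_tvDist [DecidableEq X] (hmass : ∑ x, p₁ x = ∑ x, p₀ x) {φ : X → ℝ}
    (hφ : IsTest φ) :
    rejProb p₁ φ - rejProb p₀ φ ≤ Literature.Probability.MarkovChains.tvDist p₁ p₀ := by
  have h := mul_size_sub_le_power_sub (isLRTest_lrOne p₀ p₁) hφ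
  rw [one_mul] at h
  rw [← power_sub_size_lrOne_eq_tvDist hmass]
  linarith

/-- Two-sided form: `|E₁ φ − E₀ φ| ≤ ‖p₁ − p₀‖_TV` for every test (apply the previous bound to `φ`
and to the complementary test `1 − φ`). [cite: LehmannRomano2005, §3.2 Theorem 3.2.1 (ii) (k = 1); LevinPeres2017, Remark 4.3 eq. (4.5)] -/
theorem abs_power_sub_size_le_tvDist [DecidableEq X] (hmass : ∑ x, p₁ x = ∑ x, p₀ x)
    {φ : X → ℝ} (hφ : IsTest φ) :
    |rejProb p₁ φ - rejProb p₀ φ| ≤ Literature.Probability.MarkovChains.tvDist p₁ p₀ := by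
  rw [abs_le]
  refine ⟨?_, power_sub_size_le_tvDist hmass hφ⟩
  have h := power_sub_size_le_tvDist hmass (isTest_one_sub hφ)
  rw [rejProb_one_sub, rejProb_one_sub, hmass] at h
  linarith

end TotalVariation

end Literature.Probability.HypothesisTesting
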